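import Summits.AnomalousDissipation.AnomalousDissipation.Theorems.GalerkinInvariantLoud.Negative.Clauses
import Summits.AnomalousDissipation.AnomalousDissipation.Theorems.MomentParityResolvedDissipationStubLimitSSS
import Summits.AnomalousDissipation.AnomalousDissipation.Theorems.MomentParityResolvedDissipationStubTightExtraction
import Mathlib.Topology.MetricSpace.Thickening

/-!
# Stub `stub_upperSemicontinuity` of the line `conley-continuation-loud-saddles`
# (crux stmt-AnomalousDissipation-14283, `MomentParity.GalerkinInvariantLoud`):
# upper semicontinuity of invariant Galerkin laws onto a compact loud carrier (fixed `ν > 0`)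

**Statement.** Let `K ⊆ H = L²_σ(T³)` be norm-compact and suppose EVERY probability law carried by
`K` (`μ(H ∖ K) = 0`) which satisfies the Foias–Prodi generator identity
`∫ ⟨F(u), Φ'(u)⟩ dμ = 0` for every cylindrical test functional `Φ` (the stationarity clause of a
stationary statistical solution of Navier–Stokes at `(ν, f)`, `f` smooth) has energy `< E` and
dissipation `> ε`. If the sets `Ks N ⊆ H` are eventually level-`N` and accumulate on `K` in the norm
of `H` (`∀ η > 0`, eventually every point of `Ks N` is `η`-close to `K`), then for all large `N` every
all-order invariant Galerkin law carried by `Ks N` (`IsInvariant ν f N μ`) has energy `≤ E` and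
dissipation `≥ ε`.

**Proof** (upper semicontinuity of the set of invariant measures, Foias–Manley–Rosa–Temam 2001,
Ch. IV §1–§3; the compactness is Rellich–Prokhorov).
* §1 Otherwise there are levels `N_i → ∞` and invariant laws `μ_i` carried by `Ks N_i`, all failing
  the SAME clause (energy `> E`, or dissipation `< ε`). Eventually `Ks N ⊆ B̄_R` (`K` is bounded,
  accumulation at `η = 1`), so the `μ_i` are admissible: level `N_i`, ball `R`, polynomially stationary
  at every degree (`isInvariant_iff_forall`), with the `N`-uniform enstrophy budget
  `∫‖∇u‖² dμ_i ≤ ‖f‖₂R/ν` of the energy row (`ensembleEnstrophy_le_energyRowBudget`, a copy of the internal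
  `hbudget` block of `MomentParityResolvedDissipation.LimitSSS.lintegral_eGradNormSq_limit_le`).
* §2 `MomentParityResolvedDissipation.TightExtraction.stub_tightExtraction` extracts a limit law `μ_∞`
  on `H` (bounded-continuous convergence + the lsc portmanteau). It is carried by `K`
  (`measure_compl_eq_zero_of_lsc`): the indicator of the open set `(cthickening η K)ᶜ` is lower
  semicontinuous and eventually `μ_i`-null, and `K = ⋂ₙ cthickening (1/(n+1)) K` since `K` is closed.
  It satisfies the generator identity for every cylindrical test
  (`MomentParityResolvedDissipation.LimitSSS.generator_limit`). So the window applies to `μ_∞`.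
* §3 Energy mode: `u ↦ min(‖u‖², R²)` is bounded continuous and equals `‖u‖²` on the ball, so
  `energy μ_∞ = lim energy μ_i ≥ E` — contradiction. Dissipation mode: `u ↦ ‖∇u‖²` is lower
  semicontinuous on `H` (`Torus.lowerSemicontinuous_eGradNormSq_coe`), so
  `enstrophy μ_∞ ≤ liminf enstrophy μ_i ≤ ε/ν` — contradiction.

References: C. Foias, O. Manley, R. Rosa, R. Temam, *Navier–Stokes Equations and Turbulence*
(CUP 2001), Ch. IV §1 (measures on `H`, Def. 1.3), §3; P. Billingsley, *Convergence of Probability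
Measures*, Thms 2.1, 5.1.
-/

set_option linter.dupNamespace false

noncomputable section

namespace Summit.AnomalousDissipation.AnomalousDissipation.Theorems.GalerkinInvariantLoud.UpperSemicontinuity

open MeasureTheory Filter Topology Set Metric
open scoped ENNReal
open Literature.Analysis.FunctionSpaces Literature.Analysis.FluidPDE
open Summit.AnomalousDissipation.AnomalousDissipation.Theses.MomentParity
open Summit.AnomalousDissipation.AnomalousDissipation.Theorems.CubicParityLoud.Negative (T3 R3 H3)
open Summit.AnomalousDissipation.AnomalousDissipation.Theorems.QuarticGate.Negative (IsLevel IsBandTest polyGrad IsPolyStationary)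
open Summit.AnomalousDissipation.AnomalousDissipation.Theorems.GalerkinInvariantLoud.Negative (IsInvariant isInvariant_iff_forall)

/-! ## §1 The `N`-uniform enstrophy budget of an admissible law -/

/-- **Uniform enstrophy budget** `∫‖∇u‖² dμ ≤ ‖f‖₂ R / ν` of a polynomially `3`-stationary level-`N`
probability law supported in the ball `‖u‖ ≤ R` (`0 < ν`): energy row `ν∫‖∇u‖² = ∫(u,f)`
(`QuarticGate.Negative.ensembleDissipation_eq_of_polyStationary`), Cauchy–Schwarz
(`CubicParityLoud.Negative.integral_pairing_le`), finiteness of the enstrophy at level `N`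
(`QuarticGate.Negative.ensembleEnstrophy_le_of_level`). This is a copy of the internal `hbudget`
block of `MomentParityResolvedDissipation.LimitSSS.lintegral_eGradNormSq_limit_le`
(`Theorems/MomentParityResolvedDissipationStubLimitSSSShell.lean`), which is a `have` and hence not
importable (the same block is `ensembleEnstrophy_le_budget` of the planner's skeleton
`Cruxes/ResolvedDissipation/Lines/lions_l4_domination.lean`, not importable from `Theorems`). [folklore] -/
theorem ensembleEnstrophy_le_energyRowBudget {ν : ℝ} {f : T3 → R3} {R : ℝ} (hν : 0 < ν)
    (hf : MemLp f 2 volume) {N : ℕ} {μ : Measure H3} [IsProbabilityMeasure μ]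
    (hl : ∀ᵐ u ∂μ, IsLevel N u) (hb : ∀ᵐ u ∂μ, ‖u‖ ≤ R) (hs : IsPolyStationary ν f N 3 μ) :
    Torus.ensembleEnstrophy μ ≤ ((Real.sqrt (∫ x, ‖f x‖ ^ 2) * R / ν).toNNReal : ℝ≥0∞) := by
  haveI : (ae μ).NeBot := ae_neBot.2 (IsProbabilityMeasure.ne_zero μ)
  obtain ⟨u₀, hu₀⟩ := hb.exists
  have hR0 : 0 ≤ R := (norm_nonneg _).trans hu₀
  have h2 : Integrable (fun u : H3 => ‖u‖ ^ 2) μ :=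
    Integrable.of_bound (continuous_norm.pow 2).aestronglyMeasurable (R ^ 2) (hb.mono fun u hu => by
      rw [Real.norm_eq_abs, abs_of_nonneg (by positivity)]
      exact pow_le_pow_left₀ (norm_nonneg _) hu 2)
  have hE : Torus.ensembleEnergy μ ≤ R ^ 2 := by
    unfold Torus.ensembleEnergy
    calc ∫ u, ‖u‖ ^ 2 ∂μ ≤ ∫ _u, R ^ 2 ∂μ := integral_mono_ae h2 (integrable_const _)
          (hb.mono fun u hu => pow_le_pow_left₀ (norm_nonneg _) hu 2)
      _ = R ^ 2 := by simp
  have hdiss : Torus.ensembleDissipation ν μ ≤ Real.sqrt (∫ x, ‖f x‖ ^ 2) * R := by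
    rw [QuarticGate.Negative.ensembleDissipation_eq_of_polyStationary f hf hl h2 le_rfl hs]
    refine (CubicParityLoud.Negative.integral_pairing_le hf h2).trans ?_
    gcongr
    calc Real.sqrt (Torus.ensembleEnergy μ) ≤ Real.sqrt (R ^ 2) := Real.sqrt_le_sqrt hE
      _ = R := Real.sqrt_sq hR0
  have hne : Torus.ensembleEnstrophy μ ≠ ⊤ := by
    have h1 := QuarticGate.Negative.ensembleEnstrophy_le_of_level hl
    have h3 : ∫⁻ u : H3, ‖u‖ₑ ^ 2 ∂μ ≤ ∫⁻ _u : H3, ENNReal.ofReal (R ^ 2) ∂μ :=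
      lintegral_mono_ae (hb.mono fun u hu => by
        rw [← ofReal_norm, ← ENNReal.ofReal_pow (norm_nonneg _)]
        exact ENNReal.ofReal_le_ofReal (pow_le_pow_left₀ (norm_nonneg _) hu 2))
    rw [lintegral_const, measure_univ, mul_one] at h3
    exact ne_top_of_le_ne_top
      (ENNReal.mul_ne_top ENNReal.ofReal_ne_top (ne_top_of_le_ne_top ENNReal.ofReal_ne_top h3)) h1
  unfold Torus.ensembleDissipation at hdiss
  rw [← ENNReal.ofReal_toReal hne]
  refine ENNReal.ofReal_le_ofReal ?_
  rw [le_div_iff₀ hν, mul_comm]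
  exact hdiss

/-! ## §2 The limit law is carried by the compact carrier -/

/-- **Support of the limit law.** If `∫ G dμ_∞ ≤ liminf ∫ G dμ_i` for every lower semicontinuous
`G : H → [0, ∞]` (lsc portmanteau) and, for every `η > 0`, the complement of the closed
`η`-thickening of the closed set `K` is eventually `μ_i`-null, then `μ_∞(H ∖ K) = 0`: the indicator
of the open set `(cthickening η K)ᶜ` is lower semicontinuous, so that set is `μ_∞`-null, and
`H ∖ K = ⋃ₙ (cthickening (1/(n+1)) K)ᶜ` because `K = closure K = ⋂_{δ>0} cthickening δ K`. [folklore] -/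
theorem measure_compl_eq_zero_of_lsc {K : Set H3} (hK : IsClosed K)
    {μs : ℕ → Measure H3} {μlim : Measure H3}
    (hLSC : ∀ G : H3 → ℝ≥0∞, LowerSemicontinuous G →
      ∫⁻ u, G u ∂μlim ≤ liminf (fun i => ∫⁻ u, G u ∂(μs i)) atTop)
    (hnear : ∀ η : ℝ, 0 < η → ∀ᶠ i in atTop, μs i (cthickening η K)ᶜ = 0) :
    μlim Kᶜ = 0 := by
  -- each open set `(cthickening η K)ᶜ`, `η > 0`, is `μlim`-null
  have hη : ∀ η : ℝ, 0 < η → μlim (cthickening η K)ᶜ = 0 := by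
    intro η hη
    have hU : IsOpen (cthickening η K)ᶜ := isClosed_cthickening.isOpen_compl
    have hG : LowerSemicontinuous ((cthickening η K)ᶜ.indicator fun _ => (1 : ℝ≥0∞)) :=
      hU.lowerSemicontinuous_indicator zero_le_one
    have h1 : μlim (cthickening η K)ᶜ ≤ liminf (fun i => μs i (cthickening η K)ᶜ) atTop := by
      simpa only [lintegral_indicator_const hU.measurableSet, one_mul] using hLSC _ hG
    refine le_antisymm (h1.trans ?_) bot_le
    exact liminf_le_of_frequently_le' ((hnear η hη).frequently.mono fun i hi => hi.le)
  -- `Kᶜ` is a countable union of such sets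
  have hsub : Kᶜ ⊆ ⋃ n : ℕ, (cthickening (1 / ((n : ℝ) + 1)) K)ᶜ := by
    intro x hx
    have hx' : x ∉ closure K := by rwa [hK.closure_eq]
    rw [closure_eq_iInter_cthickening] at hx'
    simp only [mem_iInter, not_forall] at hx'
    obtain ⟨δ, hδ, hxδ⟩ := hx'
    obtain ⟨n, hn⟩ := exists_nat_one_div_lt hδ
    exact mem_iUnion.2 ⟨n, fun h => hxδ (cthickening_mono hn.le K h)⟩
  exact measure_mono_null hsub (measure_iUnion_null fun n => hη _ (by positivity))

/-! ## §3 No admissible sequence accumulating on `K` fails a clause of the window constantly -/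

/-- **Core of the contradiction.** Let `K` be closed with the loud window (every probability law
carried by `K` with the generator identity for every cylindrical test has energy `< E` and dissipation
`> ε`), `0 < ν`, `f ∈ L²`, `0 ≤ R`. There is NO sequence of admissible laws `μ_i` (probability,
level `N_i → ∞`, ball `R`, polynomially stationary at every degree) accumulating on `K`
(`μ_i (cthickening η K)ᶜ = 0` eventually, every `η > 0`) which constantly violates one clause:
`E < energy μ_i` for all `i`, or `dissipation μ_i < ε` for all `i`. Proof: uniform enstrophy budget
(§1), Rellich–Prokhorov extraction (`stub_tightExtraction`), the limit is carried by `K` (§2) and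
satisfies the generator identity (`LimitSSS.generator_limit`), so it is in the window; but the energy
passes to the limit (bounded continuous clamp `min(‖u‖², R²)`) and the enstrophy is lower
semicontinuous (`Torus.lowerSemicontinuous_eGradNormSq_coe` + portmanteau). [folklore] -/
theorem false_of_constant_failure {ν : ℝ} {f : T3 → R3} {E ε : ℝ} {K : Set H3} (hν : 0 < ν)
    (hf : MemLp f 2 volume) (hK : IsClosed K)
    (hwin : ∀ μ : Measure H3, IsProbabilityMeasure μ → μ Kᶜ = 0 →
      (∀ Φ : Torus.CylindricalTest (Fin 3),
        Integrable (fun u => Torus.nsGeneratorPairing ν f u (Φ.grad u)) μ ∧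
          ∫ u, Torus.nsGeneratorPairing ν f u (Φ.grad u) ∂μ = 0) →
      Torus.ensembleEnergy μ < E ∧ ε < Torus.ensembleDissipation ν μ)
    {R : ℝ} (hR : 0 ≤ R) {Nl : ℕ → ℕ} {μ : ℕ → Measure H3} (hp : ∀ i, IsProbabilityMeasure (μ i))
    (hl : ∀ i, ∀ᵐ u ∂(μ i), IsLevel (Nl i) u) (hb : ∀ i, ∀ᵐ u ∂(μ i), ‖u‖ ≤ R)
    (hs : ∀ i (d : ℕ), IsPolyStationary ν f (Nl i) d (μ i)) (hN : Tendsto Nl atTop atTop)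
    (hnear : ∀ η : ℝ, 0 < η → ∀ᶠ i in atTop, μ i (cthickening η K)ᶜ = 0)
    (hbad : (∀ i, E < Torus.ensembleEnergy (μ i)) ∨ (∀ i, Torus.ensembleDissipation ν (μ i) < ε)) :
    False := by
  -- §1 the uniform budget and §2 the extraction
  set M : NNReal := (Real.sqrt (∫ x, ‖f x‖ ^ 2) * R / ν).toNNReal with hM_def
  have hM : ∀ i, Torus.ensembleEnstrophy (μ i) ≤ (M : ℝ≥0∞) := fun i => by
    haveI := hp i
    exact ensembleEnstrophy_le_energyRowBudget hν hf (hl i) (hb i) (hs i 3)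
  obtain ⟨φ, hφ, μlim, hplim, hblim, hBC, hLSC, -, -⟩ :=
    MomentParityResolvedDissipation.TightExtraction.stub_tightExtraction R M μ hp hb hM
  haveI := hplim
  have hφt : Tendsto φ atTop atTop := hφ.tendsto_atTop
  -- the limit law is carried by `K` ...
  have hKnull : μlim Kᶜ = 0 :=
    measure_compl_eq_zero_of_lsc hK hLSC fun η hη => hφt.eventually (hnear η hη)
  -- ... and satisfies the generator identity for every cylindrical test functional
  have hrows : ∀ Φ : Torus.CylindricalTest (Fin 3),
      Integrable (fun u => Torus.nsGeneratorPairing ν f u (Φ.grad u)) μlim ∧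
        ∫ u, Torus.nsGeneratorPairing ν f u (Φ.grad u) ∂μlim = 0 := fun Φ =>
    MomentParityResolvedDissipation.LimitSSS.generator_limit hf hR (fun i => hp (φ i))
      (fun i => hl (φ i)) (fun i => hb (φ i)) (fun i d => hs (φ i) d) (hN.comp hφt) hblim hBC Φ
  -- hence it lies in the loud window
  obtain ⟨hElt, hDgt⟩ := hwin μlim hplim hKnull hrows
  rcases hbad with hEbad | hDbad
  · -- §3 energy mode: the clamped energy is bounded continuous and passes to the limit
    set g : H3 → ℝ := fun u => min (‖u‖ ^ 2) (R ^ 2) with hg_def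
    have hgc : Continuous g := (continuous_norm.pow 2).min continuous_const
    have hgb : ∀ u, |g u| ≤ R ^ 2 := fun u => by
      rw [hg_def, abs_of_nonneg (le_min (sq_nonneg ‖u‖) (sq_nonneg R))]
      exact min_le_right _ _
    have hgeq : ∀ u : H3, ‖u‖ ≤ R → g u = ‖u‖ ^ 2 := fun u hu =>
      min_eq_left (pow_le_pow_left₀ (norm_nonneg _) hu 2)
    have hrepr : ∀ ρ : Measure H3, (∀ᵐ u ∂ρ, ‖u‖ ≤ R) → ∫ u, g u ∂ρ = Torus.ensembleEnergy ρ :=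
      fun ρ hρ => integral_congr_ae (hρ.mono fun u hu => hgeq u hu)
    have hconv : Tendsto (fun i => Torus.ensembleEnergy (μ (φ i))) atTop
        (𝓝 (Torus.ensembleEnergy μlim)) := by
      have h := hBC g hgc ⟨R ^ 2, hgb⟩
      rw [hrepr μlim hblim] at h
      refine h.congr fun i => ?_
      exact hrepr _ (hb (φ i))
    have hge : E ≤ Torus.ensembleEnergy μlim := ge_of_tendsto' hconv fun i => (hEbad (φ i)).le
    exact absurd hElt (not_lt.2 hge)
  · -- §3 dissipation mode: the enstrophy is lower semicontinuous on `H`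
    have hε : 0 < ε := by
      have h0 : 0 ≤ Torus.ensembleDissipation ν (μ 0) :=
        mul_nonneg hν.le ENNReal.toReal_nonneg
      exact h0.trans_lt (hDbad 0)
    have hεν : 0 ≤ ε / ν := by positivity
    have hle : ∀ i, Torus.ensembleEnstrophy (μ i) ≤ ENNReal.ofReal (ε / ν) := fun i => by
      have hne : Torus.ensembleEnstrophy (μ i) ≠ ⊤ := ne_top_of_le_ne_top ENNReal.coe_ne_top (hM i)
      rw [← ENNReal.ofReal_toReal hne]
      refine ENNReal.ofReal_le_ofReal (le_of_lt ?_)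
      rw [lt_div_iff₀ hν, mul_comm]
      exact hDbad i
    have hlim : Torus.ensembleEnstrophy μlim ≤ ENNReal.ofReal (ε / ν) :=
      (hLSC _ Torus.lowerSemicontinuous_eGradNormSq_coe).trans
        (liminf_le_of_frequently_le' (Frequently.of_forall fun i =>
          show Torus.ensembleEnstrophy (μ (φ i)) ≤ _ from hle (φ i)))
    have hreal : (Torus.ensembleEnstrophy μlim).toReal ≤ ε / ν := by
      have h := ENNReal.toReal_mono ENNReal.ofReal_ne_top hlim
      rwa [ENNReal.toReal_ofReal hεν] at h
    have hD : Torus.ensembleDissipation ν μlim ≤ ε := by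
      unfold Torus.ensembleDissipation
      calc ν * (Torus.ensembleEnstrophy μlim).toReal ≤ ν * (ε / ν) :=
            mul_le_mul_of_nonneg_left hreal hν.le
        _ = ε := by field_simp
    exact absurd hDgt (not_lt.2 hD)

/-! ## §4 The stub -/

/-- **Stub 2 (upper semicontinuity of invariant Galerkin laws onto a compact loud carrier, fixed
`ν > 0`).** Let `K ⊆ H` be norm-compact and suppose EVERY law carried by `K` that is stationary for
Navier–Stokes at `(ν, f)` (probability, `μ(H ∖ K) = 0`, generator identity for every cylindrical test
functional) has energy `< E` and dissipation `> ε`. If the sets `Ks N` are eventually level-`N` and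
accumulate on `K` in the norm of `H`, then for all large `N` every all-order invariant Galerkin law carried
by `Ks N` has energy `≤ E` and dissipation `≥ ε`.
Proof: otherwise choose `N_i → ∞` and bad invariant laws `μ_i` carried by `Ks N_i`
(`Filter.extraction_of_frequently_atTop`), all failing the same clause after a further extraction;
eventually `Ks N ⊆ B̄_R` (`K` bounded, accumulation at `η = 1`), so the `μ_i` are admissible
(level `N_i`, ball `R`, `∀ d, IsPolyStationary` by `isInvariant_iff_forall`) and accumulate on `K`
(`Ks N ⊆ thickening η K` eventually); `false_of_constant_failure` concludes.
(Foias–Manley–Rosa–Temam 2001, Ch. IV §1, §3.) [folklore] -/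
theorem stub_upperSemicontinuity :
    ∀ (ν : ℝ) (f : T3 → R3) (E ε : ℝ) (K : Set H3) (Ks : ℕ → Set H3), 0 < ν → Torus.IsSmooth f →
      IsCompact K →
      (∀ μ : Measure H3, IsProbabilityMeasure μ → μ Kᶜ = 0 →
        (∀ Φ : Torus.CylindricalTest (Fin 3),
          Integrable (fun u => Torus.nsGeneratorPairing ν f u (Φ.grad u)) μ ∧
            ∫ u, Torus.nsGeneratorPairing ν f u (Φ.grad u) ∂μ = 0) →
        Torus.ensembleEnergy μ < E ∧ ε < Torus.ensembleDissipation ν μ) →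
      (∀ᶠ N in atTop, ∀ a ∈ Ks N, IsLevel N a) →
      (∀ η : ℝ, 0 < η → ∀ᶠ N in atTop, ∀ a ∈ Ks N, ∃ b ∈ K, ‖a - b‖ < η) →
      ∀ᶠ N in atTop, ∀ μ : Measure H3, IsProbabilityMeasure μ → μ (Ks N)ᶜ = 0 →
        IsInvariant ν f N μ → Torus.ensembleEnergy μ ≤ E ∧ ε ≤ Torus.ensembleDissipation ν μ := by
  intro ν f E ε K Ks hν hfs hKc hwin hlev hacc
  have hf : MemLp f 2 volume := hfs.memLp 2
  -- the radius: `K` is bounded and the sets `Ks N` are eventually within distance `1` of `K`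
  obtain ⟨R₀, hR₀⟩ := hKc.isBounded.subset_closedBall (0 : H3)
  set R : ℝ := |R₀| + 1 with hR_def
  have hR : 0 ≤ R := by positivity
  have hball : ∀ᶠ N in atTop, ∀ a ∈ Ks N, ‖a‖ ≤ R := by
    filter_upwards [hacc 1 one_pos] with N hN a ha
    obtain ⟨b, hb, hab⟩ := hN a ha
    have hb' : ‖b‖ ≤ R₀ := mem_closedBall_zero_iff.1 (hR₀ hb)
    have hsub : ‖a‖ - ‖b‖ ≤ ‖a - b‖ := norm_sub_norm_le a b
    have habs : R₀ ≤ |R₀| := le_abs_self R₀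
    linarith
  -- suppose not: frequently in `N` there is a bad invariant law carried by `Ks N`
  by_contra hcon
  have hfreq : ∃ᶠ N in atTop, ∃ μ : Measure H3, IsProbabilityMeasure μ ∧ μ (Ks N)ᶜ = 0 ∧
      IsInvariant ν f N μ ∧ ¬(Torus.ensembleEnergy μ ≤ E ∧ ε ≤ Torus.ensembleDissipation ν μ) := by
    rw [not_eventually] at hcon
    refine hcon.mono fun N hN => ?_
    by_contra h'
    exact hN fun μ hpμ hKs hinv => by_contra fun hno => h' ⟨μ, hpμ, hKs, hinv, hno⟩
  -- levels `Nl i → ∞` carrying bad laws, level-`Nl i` sets inside the ball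
  obtain ⟨Nl, hNl, hP⟩ := extraction_of_frequently_atTop
    ((hfreq.and_eventually hlev).and_eventually hball)
  choose μ hpμ hKs hinv hfail using fun i => (hP i).1.1
  have hNlt : Tendsto Nl atTop atTop := hNl.tendsto_atTop
  have hae : ∀ i, ∀ᵐ u ∂(μ i), u ∈ Ks (Nl i) := fun i => by
    rw [ae_iff]
    exact hKs i
  have hl : ∀ i, ∀ᵐ u ∂(μ i), IsLevel (Nl i) u := fun i =>
    (hae i).mono fun u hu => (hP i).1.2 u hu
  have hb : ∀ i, ∀ᵐ u ∂(μ i), ‖u‖ ≤ R := fun i => (hae i).mono fun u hu => (hP i).2 u hu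
  have hs : ∀ i (d : ℕ), IsPolyStationary ν f (Nl i) d (μ i) := fun i =>
    isInvariant_iff_forall.1 (hinv i)
  -- the bad laws accumulate on `K`
  have hnear : ∀ η : ℝ, 0 < η → ∀ᶠ i in atTop, μ i (cthickening η K)ᶜ = 0 := by
    intro η hη
    filter_upwards [hNlt.eventually (hacc η hη)] with i hi
    refine measure_mono_null ?_ (hKs i)
    intro u hu huKs
    obtain ⟨b, hbK, hub⟩ := hi u huKs
    exact hu (thickening_subset_cthickening η K
      (mem_thickening_iff.2 ⟨b, hbK, by rwa [dist_eq_norm]⟩))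
  -- split the failure into a constant mode along a further subsequence
  have hmode : ∀ i, E < Torus.ensembleEnergy (μ i) ∨ Torus.ensembleDissipation ν (μ i) < ε :=
    fun i => by
    rcases not_and_or.1 (hfail i) with h | h
    · exact Or.inl (not_le.1 h)
    · exact Or.inr (not_le.1 h)
  by_cases hEfreq : ∃ᶠ i in atTop, E < Torus.ensembleEnergy (μ i)
  · obtain ⟨ψ, hψ, hψE⟩ := extraction_of_frequently_atTop hEfreq
    have hψt : Tendsto ψ atTop atTop := hψ.tendsto_atTop
    exact false_of_constant_failure hν hf hKc.isClosed hwin hR (fun i => hpμ (ψ i))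
      (fun i => hl (ψ i)) (fun i => hb (ψ i)) (fun i d => hs (ψ i) d) (hNlt.comp hψt)
      (fun η hη => hψt.eventually (hnear η hη)) (Or.inl hψE)
  · rw [not_frequently] at hEfreq
    obtain ⟨ψ, hψ, hψD⟩ := extraction_of_eventually_atTop
      (hEfreq.mono fun i hi => (hmode i).resolve_left hi)
    have hψt : Tendsto ψ atTop atTop := hψ.tendsto_atTop
    exact false_of_constant_failure hν hf hKc.isClosed hwin hR (fun i => hpμ (ψ i))
      (fun i => hl (ψ i)) (fun i => hb (ψ i)) (fun i d => hs (ψ i) d) (hNlt.comp hψt)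
      (fun η hη => hψt.eventually (hnear η hη)) (Or.inr hψD)

end Summit.AnomalousDissipation.AnomalousDissipation.Theorems.GalerkinInvariantLoud.UpperSemicontinuity

end
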